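import Summits.ValiantsHypothesis.ValiantsHypothesis.Theorems.SymPencilPerFourHessianToric

/-!
# Route `SymPencil` — `sdc(per_4) ≥ 25` by the Hessian-rank route (Task T1 discharged without the
# `7`-dimensional trichotomy; `--supports` stmt-ValiantsHypothesis-5674 `SdcSuperquadratic`)

`SymPencilSdcPerFourTwentyFive.twentyFive_le_of_noLowRank_seven` (val-width-5674-p1 / 5676-p2 g3)
proves the rung `sdc(per_4) ≥ 25` from the hypothesis `T1`: no `7`-dimensional `V ⊆ Sing Z(per_4)`
has `rank (Hess per_4) ≤ 5` along `V` (a `5`-square family per direction).  The tree discharges the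
rung through the trichotomy `SymPencilBoxFourSeven` (and `SymPencilPerFourLowRankSeven`).  This
file records the SECOND, trichotomy-free discharge: `T1` is
`SymPencilPerFourHessianToric.finrank_le_six_of_sum_sq_swap` (this seat: Hessian `6 × 6` minors ⇒
row/column partners ⇒ control lemma ⇒ rows of rank `4, 3` impossible ⇒ toric case by single-row
elements, matrix units and `3 × 3` blocks), giving `noLowRank_seven`; feeding it to
`twentyFive_le_of_noLowRank_seven` re-proves the landed `twentyFive_le_of_isSymm_isAffineDetRepr_perPoly_four`
(not restated here).

Honest framing: an alternative proof of an already-landed rung (`25`); the crux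
`SdcSuperquadratic` stays open; `VP ≠ VNP` is not moved. [folklore]
-/

noncomputable section

-- single-conjunct layout: Sub = Summit, duplicated namespace component intended
set_option linter.dupNamespace false

namespace Summit.ValiantsHypothesis.ValiantsHypothesis.Theorems.SymPencilSdcPerFourTwentyFiveViaHessianRank

open Matrix MvPolynomial Module
open Literature.Computability.AlgebraicComplexity
open Summit.ValiantsHypothesis.ValiantsHypothesis.Theorems.SymPencilPerFourHessianToric

variable {K : Type*} [Field K] [CharZero K]

/-- **Task T1, in the shape of the hypothesis of `twentyFive_le_of_noLowRank_seven`**: no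
`7`-dimensional linear subspace of `Sing Z(per_4)` carries a `5`-square family of
`s²`-coefficients per direction. [folklore] -/
theorem noLowRank_seven : ∀ V : Submodule K (Fin 4 × Fin 4 → K),
    (∀ x ∈ V, ∀ (r c : Fin 3 → Fin 4), Function.Injective r → Function.Injective c →
      ((Matrix.of fun i j => x (i, j)).submatrix r c).permanent = 0) →
    finrank K V = 7 → ∀ c : Fin 5 → K,
    ¬ (∀ y ∈ V, ∃ Λ : Fin 5 → ((Fin 4 × Fin 4 → K) →ₗ[K] K),
        ∀ u : Fin 4 × Fin 4 → K, ∃ e₀ e₁ : K, ∀ s : K,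
          eval (u + s • y) (perPoly (Fin 4) K) = e₀ + s * e₁ + s ^ 2 * ∑ k, c k * (Λ k u) ^ 2) := by
  intro V hV3 h7 c hfam
  have h6 := finrank_le_six_of_sum_sq_swap (ι := Fin 5) (by rw [Fintype.card_fin]; norm_num) V hV3
    fun y hy => by
      obtain ⟨Λ, hΛ⟩ := hfam y hy
      exact ⟨c, Λ, hΛ⟩
  omega

end Summit.ValiantsHypothesis.ValiantsHypothesis.Theorems.SymPencilSdcPerFourTwentyFiveViaHessianRank

end
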